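import Summits.AtomisticToContinuum.FouriersLaw.Theorems.HiddenChargeMazurOddChargeAlgebraEnds
import Summits.AtomisticToContinuum.FouriersLaw.Theorems.HiddenChargeMazurOddChargeAlgebraCore3
import Summits.AtomisticToContinuum.FouriersLaw.Theorems.HiddenChargeMazurOddChargeAlgebraPairLinearRows

/-!
# Odd conservation laws of the pinned anharmonic chain — the p-linear leading pair

File PAIRLINEAR of the NEGATIVE edge of crux `HiddenChargeMazur.OddChargeExists`
(item stmt-AtomisticToContinuum-13511).  For a leading p-linear member
`F = Σ_{y=0}^{D} a_y p_y` of span `D ≥ 1` (coefficients `a_y ∈ ℝ[q_0, …, q_D]` homogeneous of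
degree `n`) paired with a density `H` on the sites `0, …, D-1` of momentum degree `3` by the
boundary equation `(α) bup D F = 0` and the transport equation `(β) A⁺ F + bup (D-1) H = 0`,
the member is free of site `0`: `a_0 = 0` and `∂_{q_0} a_y = 0` for all `y` (`pair_linear`).

Assembly (crux workfile MATH §4): the row identities of `(β)` (`pair_linear_rows`) and the
boundary identity (`bup_plinear`) feed `ends_closed_form` (`a_0 = c·lead0 D`, `a_D = c·leadD D`);
for `n ≥ 2` the strain entries restricted to `q_D = 0` make `ã_y := killVar q_D a_y` a
polynomial Killing field on `q_0, …, q_{D-1}`, which vanishes by homogeneity (`∂³` trick +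
Killing rigidity), so `core_clash` gives `c = 0`; for `n ≤ 1` the degree of `lead0 D` gives
`c = 0` directly.  Finally the two rows are cross-differentiated, `nu_form` and the momentum
grading kill `Ξ = ∂_{p_0}∂_{p_{D-1}} H`, and row `0` yields `∂_{q_0} a_y = 0`.
Elementary polynomial algebra in `MvPolynomial (ℤ ⊕ ℤ) ℝ`. [folklore]
-/

noncomputable section

open MvPolynomial
open scoped BigOperators

namespace Summit.AtomisticToContinuum.FouriersLaw.Theorems.OddChargeAlgebra

/-! ### Local toolkit -/

/-- Distinct sites give distinct position variables. [folklore] -/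
private theorem inl_ne' {x y : ℤ} (h : x ≠ y) : (Sum.inl x : Var) ≠ Sum.inl y :=
  fun e => h (Sum.inl_injective e)

/-- Numerals `≥ 2` are nonzero in `𝓡` (characteristic zero). [folklore] -/
private theorem ofNat_ne_zero' (n : ℕ) [n.AtLeastTwo] : (OfNat.ofNat n : R) ≠ 0 := by
  rw [← map_ofNat C n, Ne, C_eq_zero]
  exact (Nat.cast_ne_zero (R := ℝ)).2 (NeZero.ne n)

/-- `killVar v f` does not involve the variable `v`. [folklore] -/
private theorem pderiv_killVar_self' (v : Var) (f : R) : pderiv v (killVar v f) = 0 := by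
  induction f using MvPolynomial.induction_on with
  | C a => rw [killVar_C, pderiv_C]
  | add p q hp hq => rw [map_add, map_add, hp, hq, add_zero]
  | mul_X p w hp =>
    rw [map_mul, pderiv_mul, hp, zero_mul, zero_add]
    by_cases hw : w = v
    · rw [hw, killVar_X_self, map_zero, mul_zero]
    · rw [killVar_X_of_ne hw, pderiv_X_of_ne hw, mul_zero]

/-- `killVar v` preserves homogeneity (it substitutes the degree-one data `0`, `X w`). [folklore] -/
private theorem isHomogeneous_killVar' {f : R} {n : ℕ} (hf : f.IsHomogeneous n) (v : Var) :
    (killVar v f).IsHomogeneous n := by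
  have h := hf.aeval (fun w : Var => if w = v then (0 : R) else X w) (n := 1) (fun w => by
    by_cases hw : w = v
    · rw [if_pos hw]; exact isHomogeneous_zero _ _ _
    · rw [if_neg hw]; exact isHomogeneous_X _ _)
  rw [one_mul] at h
  exact h

/-- `cub (X u) (X w) = (X u - X w)³ + (X w)³` is homogeneous of degree `3`. [folklore] -/
private theorem isHomogeneous_cub' (u w : Var) : (cub (X u) (X w) : R).IsHomogeneous 3 := by
  have e : (cub (X u) (X w) : R) = (X u - X w) ^ 3 + X w ^ 3 := by unfold cub; ring
  rw [e]
  have h1 : ((X u - X w : R) ^ 3).IsHomogeneous 3 := by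
    simpa using ((isHomogeneous_X ℝ u).sub (isHomogeneous_X ℝ w)).pow 3
  exact h1.add (isHomogeneous_X_pow w 3)

/-- `gam j` is homogeneous of degree `1`. [folklore] -/
private theorem isHomogeneous_gam' (j : ℤ) : (gam j).IsHomogeneous 1 := by
  unfold gam
  exact (isHomogeneous_X ℝ _).sub (isHomogeneous_X ℝ _)

/-- `prodsq s` is homogeneous of degree `2·#s`. [folklore] -/
private theorem isHomogeneous_prodsq' (s : Finset ℤ) : (prodsq s).IsHomogeneous (s.card * 2) := by
  have h := IsHomogeneous.prod s (fun j => gam j ^ 2) (fun _ => 2) (fun j _ => by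
    simpa using (isHomogeneous_gam' j).pow 2)
  rw [Finset.sum_const, smul_eq_mul] at h
  exact h

/-- `lead0 D` is homogeneous of degree `3 + 2·#[0, D-1)`. [folklore] -/
private theorem isHomogeneous_lead0' (D : ℤ) :
    (lead0 D).IsHomogeneous (3 + (Finset.Ico 0 (D - 1)).card * 2) :=
  (isHomogeneous_cub' _ _).mul (isHomogeneous_prodsq' _)

/-- `lead0 D ≠ 0`. [folklore] -/
private theorem lead0_ne_zero' (D : ℤ) : lead0 D ≠ 0 :=
  mul_ne_zero (cub_inl_ne_zero (by omega)) (prodsq_ne_zero _)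

/-- `prodsq s` has momentum degree `0`. [folklore] -/
private theorem isWeightedHomogeneous_pwt_prodsq' (s : Finset ℤ) :
    IsWeightedHomogeneous pwt (prodsq s) 0 := by
  have hg : ∀ j : ℤ, IsWeightedHomogeneous pwt (gam j) 0 := fun j =>
    (weightedHomogeneousSubmodule ℝ pwt 0).sub_mem (isWeightedHomogeneous_X ℝ pwt (Sum.inl j))
      (isWeightedHomogeneous_X ℝ pwt (Sum.inl (j + 1)))
  have h := IsWeightedHomogeneous.prod s (fun j => gam j ^ 2) (fun _ => (0 : ℕ))
    (fun j _ => by simpa using (hg j).pow 2)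
  rw [Finset.sum_const_zero] at h
  exact h

/-- Coefficient extraction: `∂_{p_y} (Σ_{z ∈ s} g_z p_z) = g_y` for `p_y`-free coefficients and
`y ∈ s`. [folklore] -/
private theorem pderiv_inr_sum_mul_X' {s : Finset ℤ} {g : ℤ → R} {y : ℤ}
    (hg : ∀ z, pderiv (Sum.inr y) (g z) = 0) (hy : y ∈ s) :
    pderiv (Sum.inr y) (∑ z ∈ s, g z * X (Sum.inr z)) = g y := by
  rw [map_sum, Finset.sum_eq_single_of_mem y hy]
  · rw [pderiv_mul, hg, zero_mul, zero_add, pderiv_X_self, mul_one]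
  · intro z _ hzy
    rw [pderiv_mul, hg, zero_mul, zero_add, pderiv_X_of_ne (by simpa using hzy), mul_zero]

/-- `∂_{q_x} (Σ_{z ∈ s} g_z p_z) = Σ_{z ∈ s} (∂_{q_x} g_z) p_z`. [folklore] -/
private theorem pderiv_inl_sum_mul_X' (s : Finset ℤ) (g : ℤ → R) (x : ℤ) :
    pderiv (Sum.inl x) (∑ z ∈ s, g z * X (Sum.inr z))
      = ∑ z ∈ s, pderiv (Sum.inl x) (g z) * X (Sum.inr z) := by
  rw [map_sum]
  refine Finset.sum_congr rfl fun z _ => ?_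
  rw [pderiv_mul, pderiv_X_of_ne (show (Sum.inr z : Var) ≠ Sum.inl x from Sum.inr_ne_inl),
    mul_zero, add_zero]

/-- The site of a position variable. [folklore] -/
private theorem site_inl' (x : ℤ) : Var.site (Sum.inl x) = x := rfl

/-! ### Killing on `q_D = 0` -/

/-- KILLING (MATH §4.5).  Let `a_y ∈ ℝ[q_0, …, q_D]` be homogeneous of degree `n ≥ 2` and suppose
that the strain entries restricted to `q_D = 0` satisfy, for `0 ≤ x, y ≤ D-1`,
`killVar q_D (∂_{q_x} a_y + ∂_{q_y} a_x) = -killVar q_D (cub(q_0,q_1)) · W_{xy}` with `W_{xy}` free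
of `q_0` and `W_{xy} = 0` when `x = 0` or `y = 0`.  Then `killVar q_D a_y = 0` for `0 ≤ y ≤ D-1`:
the `∂_{q_0}³` trick makes `ã_y := killVar q_D a_y` a polynomial Killing field in `q_0..q_{D-1}`,
whose second partials vanish, and Killing rigidity concludes. [folklore] -/
private theorem killing_step' {D : ℤ} (hD : 1 ≤ D) {n : ℕ} (hn : 2 ≤ n) (a : ℤ → R)
    (hsupp : ∀ y, a y ∈ supported ℝ (Sum.inl '' Set.Icc (0 : ℤ) D))
    (hhom : ∀ y, (a y).IsHomogeneous n)
    (hE : ∀ x y : ℤ, 0 ≤ x → x ≤ D - 1 → 0 ≤ y → y ≤ D - 1 → ∃ W : R,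
      pderiv (Sum.inl 0) W = 0 ∧ (x = 0 ∨ y = 0 → W = 0) ∧
        killVar (Sum.inl D) (pderiv (Sum.inl x) (a y) + pderiv (Sum.inl y) (a x))
          = -(killVar (Sum.inl D) (cub (X (Sum.inl 0)) (X (Sum.inl 1))) * W)) :
    ∀ y, 0 ≤ y → y ≤ D - 1 → killVar (Sum.inl D) (a y) = 0 := by
  obtain ⟨b, hb⟩ : ∃ b : ℤ → R, ∀ y, b y = killVar (Sum.inl D) (a y) := ⟨_, fun _ => rfl⟩
  have hcomm : ∀ x, x ≤ D - 1 → ∀ f : R, killVar (Sum.inl D) (pderiv (Sum.inl x) f)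
      = pderiv (Sum.inl x) (killVar (Sum.inl D) f) :=
    fun x hx f => (pderiv_killVar_of_ne (inl_ne' (by omega)) f).symm
  -- the strain of `b` on `[0, D-1]²`
  have hSb : ∀ x y, 0 ≤ x → x ≤ D - 1 → 0 ≤ y → y ≤ D - 1 → ∃ W : R,
      pderiv (Sum.inl 0) W = 0 ∧ (x = 0 ∨ y = 0 → W = 0) ∧
        pderiv (Sum.inl x) (b y) + pderiv (Sum.inl y) (b x)
          = -(killVar (Sum.inl D) (cub (X (Sum.inl 0)) (X (Sum.inl 1))) * W) := by
    intro x y hx0 hx hy0 hy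
    obtain ⟨W, hW0, hWz, hW⟩ := hE x y hx0 hx hy0 hy
    refine ⟨W, hW0, hWz, ?_⟩
    rw [map_add, hcomm x hx, hcomm y hy, ← hb, ← hb] at hW
    exact hW
  -- row `x = 0`: `∂_0 b_y = -∂_y b_0`, `∂_0 b_0 = 0`, hence `∂_0² b_y = 0`
  have hS0 : ∀ y, 0 ≤ y → y ≤ D - 1 →
      pderiv (Sum.inl 0) (b y) + pderiv (Sum.inl y) (b 0) = 0 := by
    intro y hy0 hy
    obtain ⟨W, -, hWz, hW⟩ := hSb 0 y le_rfl (by omega) hy0 hy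
    rw [hW, hWz (Or.inl rfl), mul_zero, neg_zero]
  have h00 : pderiv (Sum.inl 0) (b 0) = 0 := by
    have h := hS0 0 le_rfl (by omega)
    rw [← two_mul] at h
    exact (mul_eq_zero.1 h).resolve_left (ofNat_ne_zero' 2)
  have h0sq : ∀ y, 0 ≤ y → y ≤ D - 1 →
      pderiv (Sum.inl 0) (pderiv (Sum.inl 0) (b y)) = 0 := by
    intro y hy0 hy
    have h := hS0 y hy0 hy
    rw [add_eq_zero_iff_eq_neg] at h
    rw [h, map_neg, pderiv_comm, h00, map_zero, neg_zero]
  -- all strains vanish (the `∂_0³` trick for `x, y ≥ 1`)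
  have hS : ∀ x y, 0 ≤ x → x ≤ D - 1 → 0 ≤ y → y ≤ D - 1 →
      pderiv (Sum.inl x) (b y) + pderiv (Sum.inl y) (b x) = 0 := by
    intro x y hx0 hx hy0 hy
    obtain ⟨W, hW0, hWz, hW⟩ := hSb x y hx0 hx hy0 hy
    by_cases hxy : x = 0 ∨ y = 0
    · rw [hW, hWz hxy, mul_zero, neg_zero]
    obtain ⟨hx1, hy1⟩ := not_or.1 hxy
    have hθ : killVar (Sum.inl D) (cub (X (Sum.inl 0)) (X (Sum.inl 1)))
        = cub (X (Sum.inl 0)) (X (Sum.inl 1)) :=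
      killVar_eq_self_of_pderiv (pderiv_inl_cub_of_ne (by omega) (by omega))
    rw [hθ] at hW
    have h3 : ∀ u v, u ≤ D - 1 → 0 ≤ v → v ≤ D - 1 → pderiv (Sum.inl 0) (pderiv (Sum.inl 0)
        (pderiv (Sum.inl 0) (pderiv (Sum.inl u) (b v)))) = 0 := by
      intro u v _ hv0 hv
      rw [pderiv_comm (Sum.inl 0) (Sum.inl u), pderiv_comm (Sum.inl 0) (Sum.inl u), h0sq v hv0 hv,
        map_zero, map_zero]
    have e := congrArg (fun F => pderiv (Sum.inl 0) (pderiv (Sum.inl 0) (pderiv (Sum.inl 0) F))) hW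
    simp only [map_add, map_neg] at e
    rw [h3 x y hx hy0 hy, h3 y x hy hx0 hx, add_zero,
      pderiv3_cub_mul (show (0 : ℤ) ≠ 1 by omega) hW0] at e
    have hW' : W = 0 := (mul_eq_zero.1 (neg_eq_zero.1 e.symm)).resolve_left (ofNat_ne_zero' 6)
    rw [hW, hW', mul_zero, neg_zero]
  -- `b z` is free of every variable outside `q_0, …, q_{D-1}`
  have hfree : ∀ z (v : Var), v ∉ Sum.inl '' Set.Icc (0 : ℤ) (D - 1) → pderiv v (b z) = 0 := by
    intro z v hv
    rw [hb]
    by_cases hvD : v = Sum.inl D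
    · rw [hvD]
      exact pderiv_killVar_self' _ _
    · refine pderiv_eq_zero_of_not_mem_supported (killVar_mem_supported _ (hsupp z)) ?_
      rintro ⟨x, hx, rfl⟩
      by_cases hxD : x = D
      · exact hvD (by rw [hxD])
      · exact hv ⟨x, ⟨hx.1, by have := hx.2; omega⟩, rfl⟩
  -- all second partials of `b z` vanish
  have h2nd : ∀ z, 0 ≤ z → z ≤ D - 1 → ∀ v w : Var, pderiv v (pderiv w (b z)) = 0 := by
    intro z hz0 hz v w
    by_cases hw : w ∈ Sum.inl '' Set.Icc (0 : ℤ) (D - 1)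
    swap
    · rw [hfree z w hw, map_zero]
    by_cases hv : v ∈ Sum.inl '' Set.Icc (0 : ℤ) (D - 1)
    swap
    · rw [pderiv_comm, hfree z v hv, map_zero]
    obtain ⟨x, ⟨hx0, hx⟩, rfl⟩ := hv
    obtain ⟨y, ⟨hy0, hy⟩, rfl⟩ := hw
    have eA : pderiv (Sum.inl x) (pderiv (Sum.inl y) (b z) + pderiv (Sum.inl z) (b y)) = 0 := by
      rw [hS y z hy0 hy hz0 hz, map_zero]
    have eB : pderiv (Sum.inl y) (pderiv (Sum.inl x) (b z) + pderiv (Sum.inl z) (b x)) = 0 := by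
      rw [hS x z hx0 hx hz0 hz, map_zero]
    have eC : pderiv (Sum.inl z) (pderiv (Sum.inl x) (b y) + pderiv (Sum.inl y) (b x)) = 0 := by
      rw [hS x y hx0 hx hy0 hy, map_zero]
    rw [map_add] at eA eB eC
    rw [pderiv_comm (Sum.inl y) (Sum.inl x)] at eB
    rw [pderiv_comm (Sum.inl z) (Sum.inl x), pderiv_comm (Sum.inl z) (Sum.inl y)] at eC
    have h2 : (2 : R) * pderiv (Sum.inl x) (pderiv (Sum.inl y) (b z)) = 0 := by
      linear_combination eA + eB - eC
    exact (mul_eq_zero.1 h2).resolve_left (ofNat_ne_zero' 2)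
  intro y hy0 hy
  rw [← hb]
  exact eq_zero_of_isHomogeneous_of_pderiv_pderiv (b y) n
    (by rw [hb]; exact isHomogeneous_killVar' (hhom y) _) hn (h2nd y hy0 hy)

/-! ### The headline -/

/-- PAIR-LINEAR (MATH §4).  For `D ≥ 1`, a leading p-linear member `F = Σ_{y=0}^{D} a_y p_y`
(`a_y ∈ ℝ[q_0, …, q_D]` homogeneous of degree `n`, `a_y = 0` off `[0, D]`) paired with `H`
(sites `0..D-1`, momentum degree `3`) by `bup D F = 0` and `A⁺F + bup (D-1) H = 0` is free of
site `0`: `a_0 = 0` and `∂_{q_0} a_y = 0` for every `y`.  Rows + ends give `a_0 = c·lead0 D`,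
`a_D = c·leadD D`; Killing on `q_D = 0` (`n ≥ 2`) or the degree of `lead0 D` (`n ≤ 1`) and
`core_clash` give `c = 0`; cross-differentiating the two rows, `nu_form` and the momentum grading
kill `Ξ = ∂_{p_0}∂_{p_{D-1}} H`, so row `0` reads `Σ_y ∂_{q_0} a_y · p_y = 0`. [folklore] -/
theorem pair_linear : ∀ {D : ℤ}, 1 ≤ D → ∀ (a : ℤ → R) (H : R) (n : ℕ),
    (∀ y, a y ∈ supported ℝ (Sum.inl '' Set.Icc (0 : ℤ) D)) → (∀ y, y < 0 ∨ D < y → a y = 0) →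
    (∀ y, (a y).IsHomogeneous n) → H ∈ supported ℝ (Var.site ⁻¹' Set.Icc (0 : ℤ) (D - 1)) →
    IsWeightedHomogeneous pwt H 3 → bup D (∑ y ∈ Finset.Icc 0 D, a y * X (Sum.inr y)) = 0 →
    Aplus (∑ y ∈ Finset.Icc 0 D, a y * X (Sum.inr y)) + bup (D - 1) H = 0 →
    a 0 = 0 ∧ ∀ y, pderiv (Sum.inl 0) (a y) = 0 := by
  intro D hD a H n hsupp hout hhom hH hHw hα hβ
  obtain ⟨hRow0, hRowD, hstar, hH2, hE⟩ := pair_linear_rows hD a H hsupp hout hH hβ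
  -- ENDS: `a_0 = c·lead0 D`, `a_D = c·leadD D`
  have hsite : ∀ y, a y ∈ supported ℝ (Var.site ⁻¹' Set.Icc (0 : ℤ) D) :=
    fun y => supported_mono (inl_image_Icc_subset_site 0 D) (hsupp y)
  have hα' : cub (X (Sum.inl (D + 1))) (X (Sum.inl D)) * a D
      + cub (X (Sum.inl 0)) (X (Sum.inl 1)) * shift (a 0) = 0 := by
    rw [← bup_plinear D a (by omega) hsupp]
    exact hα
  obtain ⟨c, h0, hDf⟩ := ends_closed_form hD (hsite 0) (hsite D) hα' hH2
  -- `c = 0`: Killing + core clash (`n ≥ 2`), degree count (`n ≤ 1`)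
  have hc : c = 0 := by
    by_cases hn : 2 ≤ n
    · refine core_clash hD c a hsupp hout h0 hDf hstar fun y hy => ?_
      by_cases hy0 : 0 ≤ y
      · exact killing_step' hD hn a hsupp hhom hE y hy0 hy
      · rw [hout y (Or.inl (by omega)), map_zero]
    · by_contra hc
      have hne : a 0 ≠ 0 := by
        rw [h0]
        exact mul_ne_zero (MvPolynomial.C_ne_zero.2 hc) (lead0_ne_zero' D)
      have h1 : (a 0).IsHomogeneous (3 + (Finset.Ico 0 (D - 1)).card * 2) := by
        rw [h0]
        exact (isHomogeneous_lead0' D).C_mul c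
      have := (hhom 0).inj_right h1 hne
      omega
  subst hc
  have ha0 : a 0 = 0 := by rw [h0, C_0, zero_mul]
  have haD : a D = 0 := by rw [hDf, C_0, zero_mul]
  refine ⟨ha0, ?_⟩
  -- the two rows with `a_0 = a_D = 0`
  set Ξ : R := pderiv (Sum.inr 0) (pderiv (Sum.inr (D - 1)) H)
  have hR0 : ∑ y ∈ Finset.Icc 0 D, pderiv (Sum.inl 0) (a y) * X (Sum.inr y)
      = -(cub (X (Sum.inl D)) (X (Sum.inl (D - 1))) * Ξ) := by
    rw [← hRow0, ha0, map_zero, zero_add]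
  have hRD : ∑ y ∈ Finset.Icc 0 D, pderiv (Sum.inl D) (a y) * X (Sum.inr y)
      = -(cub (X (Sum.inl 0)) (X (Sum.inl 1)) * shift Ξ) := by
    rw [← hRowD, haD, map_zero, zero_add]
  -- `Ξ` is free of `q_D`, `S Ξ` is free of `q_0`
  have hΞs : Ξ ∈ supported ℝ (Var.site ⁻¹' Set.Icc (0 : ℤ) (D - 1)) :=
    pderiv_mem_supported (pderiv_mem_supported hH _) _
  have hΞD : pderiv (Sum.inl D) Ξ = 0 :=
    pderiv_eq_zero_of_not_mem_supported hΞs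
      (by simp only [Set.mem_preimage, Set.mem_Icc, site_inl']; omega)
  have hSΞ0 : pderiv (Sum.inl 0) (shift Ξ) = 0 := by
    rw [pderiv_inl_shift', zero_sub, pderiv_eq_zero_of_not_mem_supported hΞs
      (by simp only [Set.mem_preimage, Set.mem_Icc, site_inl']; omega), map_zero]
  -- cross-differentiate: `∂_{q_D}` of row `0` and `∂_{q_0}` of row `D` have equal left sides
  have key : pderiv (Sum.inl D) (-(cub (X (Sum.inl D)) (X (Sum.inl (D - 1))) * Ξ))
      = pderiv (Sum.inl 0) (-(cub (X (Sum.inl 0)) (X (Sum.inl 1)) * shift Ξ)) := by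
    rw [← hR0, ← hRD, pderiv_inl_sum_mul_X', pderiv_inl_sum_mul_X']
    exact Finset.sum_congr rfl fun y _ => by rw [pderiv_comm]
  rw [map_neg, map_neg, pderiv_mul, pderiv_mul, hΞD, hSΞ0, mul_zero, add_zero,
    pderiv_inl_cub_left (show D ≠ D - 1 by omega),
    pderiv_inl_cub_left (show (0 : ℤ) ≠ 1 by omega)] at key
  have hdiamond : gam (D - 1) ^ 2 * Ξ = gam 0 ^ 2 * shift Ξ := by
    have e3 : (3 : R) * (gam (D - 1) ^ 2 * Ξ - gam 0 ^ 2 * shift Ξ) = 0 := by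
      simp only [gam, sub_add_cancel, zero_add]
      linear_combination (-1 : R) * key
    exact sub_eq_zero.1 ((mul_eq_zero.1 e3).resolve_left (ofNat_ne_zero' 3))
  -- NU-FORM and the momentum grading: `Ξ = c'·Π` has momentum degree `1` and `0`, so `Ξ = 0`
  obtain ⟨c', hc'⟩ := nu_form hD Ξ hdiamond
  have hΞw : IsWeightedHomogeneous pwt Ξ 1 :=
    (hHw.pderiv (i := Sum.inr (D - 1)) (n' := 2) rfl).pderiv rfl
  have hΞ0 : Ξ = 0 := by
    by_contra hne
    have h0w : IsWeightedHomogeneous pwt Ξ 0 := by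
      rw [hc']
      exact (isWeightedHomogeneous_pwt_prodsq' _).C_mul c'
    exact one_ne_zero (IsWeightedHomogeneous.inj_right hne hΞw h0w)
  -- row `0` now reads `Σ_y ∂_{q_0} a_y · p_y = 0`
  rw [hΞ0, mul_zero, neg_zero] at hR0
  intro y
  by_cases hy : 0 ≤ y ∧ y ≤ D
  · have hpfree : ∀ z, pderiv (Sum.inr y) (pderiv (Sum.inl 0) (a z)) = 0 := fun z =>
      pderiv_eq_zero_of_not_mem_supported (pderiv_mem_supported (hsupp z) _)
        (by rintro ⟨x, -, hx⟩; exact Sum.inl_ne_inr hx)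
    have e : pderiv (Sum.inr y) (∑ z ∈ Finset.Icc 0 D, pderiv (Sum.inl 0) (a z) * X (Sum.inr z))
        = pderiv (Sum.inl 0) (a y) :=
      pderiv_inr_sum_mul_X' hpfree (Finset.mem_Icc.2 hy)
    rw [hR0, map_zero] at e
    exact e.symm
  · rw [hout y (by omega), map_zero]

end Summit.AtomisticToContinuum.FouriersLaw.Theorems.OddChargeAlgebra

end
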